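import Literature.AnabelianGeometry.EtaleTheta.Discharge.Sec5OfConnectedTemperoid
import Literature.AnabelianGeometry.EtaleTheta.Discharge.Sec5RootCompositionModel

/-!
# [EtTh] Prop. 5.2 (i), FIRST alternative, for the §5 data over `B^temp(Π^tp_X)⁰` with the model pull-back — via abc-iut-w5-d134's composite root (p.324 / PDF p.98)

Mochizuki, *The étale theta function …*, Publ. RIMS **45** (2009), Prop. 5.2 (i) p.324 (PDF p.98) ("… constitutes an `l·N`-th root of
a right fraction-pair of … `Θ̈` …, or, alternatively, an `N`-th root of … an `l`-th root …"); Rmk. 4.3.2 pp.318–319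
[cite: MochizukiEtTh2009, Prop 5.2 (i) p.324 (PDF p.98)].  Seat abc-iut-L2-t4 (§5 owner), ROW W3-L2-01 «§5 GENUINE DATA»; PROOF-ONLY
companion of `Discharge/Sec5Prop52iOfConnectedTemperoid.lean` (p428278: the same statement modulo the closure data (C1) `Dc`,
(C1′) `hD`, (C2) `hsat` of abc-iut-w5-d234's `NthRoot.hcomp_of`).  Additive.

Here the composite-root binder `hcomp` (GAP G-L2t4-1) is supplied instead by abc-iut-w5-d134's
`BiKummerSetting.pairIsNthRootOf_comp_mkOfModelCanonical` (`Discharge/Sec5RootCompositionModel.lean`, p427648), valid at every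
canonical model instance — in particular at `mkOfConnectedTemperoid` — for the MODEL pull-back `pullFrac := ((α')^birat)^* =
pullFracModel`, whose residual inputs are print-faithful clauses on the `N`-domain `A_N`: `hsk` (`A_N` lies in a skeleton through
`A_⊙`), `hμ` (`A_N` is `μ_{l·N}`-saturated, Def. 4.1 (iv)(a) at degree `l·N`) and `hcondA` (condition (a) of Def. 4.1 (iii) at level
`l·N`; p.324: "follows immediately from the definition of the field `J̈_{l·N}`"):
* `ThetaFrobenioid.thetaPairIsRoot_ofConnectedTemperoidData_of_comp` — [EtTh] Prop. 5.2 (i), first alternative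
  (`FrobenioidThetaBiKummer.ThetaPairIsRoot`), for `ofConnectedTemperoidData` with `pullFrac := pullFracModel`, modulo
  {`hsk`, `hμ`, `hcondA`} (`Φ` divisorial by the [FrdI] Thm. 5.2 hypotheses `h`; `pullFracModel (𝟙 _) = id` a theorem).
HONEST FRAMING: kernel-checked implication; the three clauses are named inputs; no side taken downstream.
-/

noncomputable section

namespace Literature.AnabelianGeometry.EtaleTheta

open CategoryTheory Opposite Literature.AlgebraicGeometry.Frobenioids Literature.AnabelianGeometry.SemiGraphs
  Literature.AnabelianGeometry.SemiGraphs.GaloisObjects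

universe u₀ v₀ w

namespace ThetaFrobenioid

variable {K : Type u₀} [Field K] {X : SemiGraphs.TemperedArithmeticGroup.{u₀} K} {D₀ : Type u₀} [Category.{v₀} D₀]
  {V : FrdIMonoidStub.{w}} {T₀ : RealifiedDivisorMonoids (D₀ := D₀) V}
  {VD : FrdICatStub.{u₀ + 1, u₀, w} (ConnectedPart (BTemp X.Pi))}
  {tf : TemperedFrobenioid T₀ (ConnectedPart (BTemp X.Pi)) VD} {hZ : tf.monoidType = MonoidType.Z}
  {hP : ∀ A : (ConnectedPart (BTemp X.Pi))ᵒᵖ, IsPerfect (tf.Φ.carrier A)}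
  {NH : Subgroup (Field.absoluteGaloisGroup K) → tf.category → ℕ+ → Prop} {A₀ : tf.category}
  {hA₀ : PreFrobenioid.IsFrobeniusTrivial tf.toElem A₀} {hA₀' : SemiGraphs.IsGaloisObj A₀.base.obj}
  {lv N : ℕ+} {T : ThetaEnvData.{max u₀ w} N} {θ : tf.biratUnitsModel A₀} {Bl : tf.category}
  {Pl : (BiKummerSetting.mkOfConnectedTemperoid X tf hZ hP NH A₀ hA₀ hA₀').FractionPair θ Bl}
  {Rl : (BiKummerSetting.mkOfConnectedTemperoid X tf hZ hP NH A₀ hA₀ hA₀').NthRoot θ Pl lv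
    (fun {_} φ x => tf.pullFracModel φ x)}
  (h : ModelFrobenioid.Hypotheses tf.divisorMonoid tf.ratFnFunctor)
  (Q : FrobenioidTheta.ThetaSubquotientStub.{w} (ConnectedPart (BTemp X.Pi))) (odd_l : Odd (lv : ℕ))
  (R : (BiKummerSetting.mkOfConnectedTemperoid X tf hZ hP NH A₀ hA₀ hA₀').NthRoot Rl.root Rl.pair N
    (fun {_} φ x => tf.pullFracModel φ x))
  (ιX : T.PiX ≃ₜ* X.Pi) (K' : Type w) [Field K'] (constEmb : K'ˣ →* tf.biratUnitsModel R.BN)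
  (constEmb_injective : Function.Injective constEmb)
  (hinvc : ∀ g : Aut R.AN.base,
    pull tf.divisorMonoid g.hom (ModelFrobenioid.div R.pair.num) = ModelFrobenioid.div R.pair.num)
  (hinvp : ∀ y : T.PiX, y ∈ T.PiYdd →
    pull tf.divisorMonoid ((BiKummerSetting.mkOfConnectedTemperoid X tf hZ hP NH A₀ hA₀ hA₀').galoisSurj R.AN.base
      R.αData.isGalois (ιX y)).hom (ModelFrobenioid.div R.pair.den) = ModelFrobenioid.div R.pair.den)

/-- **[EtTh] Prop. 5.2 (i), FIRST alternative, for the §5 data over `B^temp(Π^tp_X)⁰` with the model pull-back**, modulo the three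
clauses on `A_N` of abc-iut-w5-d134's composite root: `hsk` (skeleton through `A_⊙`), `hμ` (`μ_{l·N}`-saturation), `hcondA`
(Def. 4.1 (iii)(a) at level `l·N`).  [cite: MochizukiEtTh2009, Prop 5.2 (i) p.324 (PDF p.98); Rmk 4.3.2 p.318 (PDF p.92)] -/
theorem thetaPairIsRoot_ofConnectedTemperoidData_of_comp
    (hsk : Nonempty (R.AN.base ≅ A₀.base) → R.AN = A₀) (hμ : tf.IsMuSaturated R.AN (lv * N))
    (hcondA : ∃ (A' A'' : tf.category) (s₁ : A' ⟶ R.AN) (s₂ : A' ⟶ A''),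
      (BiKummerSetting.mkOfConnectedTemperoid X tf hZ hP NH A₀ hA₀ hA₀').IsPreStep s₁ ∧
        (BiKummerSetting.mkOfConnectedTemperoid X tf hZ hP NH A₀ hA₀ hA₀').IsPreStep s₂ ∧
          (BiKummerSetting.mkOfConnectedTemperoid X tf hZ hP NH A₀ hA₀ hA₀').IsFrobeniusTrivial A'' ∧
            (BiKummerSetting.mkOfConnectedTemperoid X tf hZ hP NH A₀ hA₀ hA₀').IsNHSaturatedBsFld
              (BiKummerSetting.mkOfConnectedTemperoid X tf hZ hP NH A₀ hA₀ hA₀').HodotBsFld A'' (lv * N)) :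
    FrobenioidThetaBiKummer.ThetaPairIsRoot
      (ofConnectedTemperoidData (pullFrac := fun {_ _} φ x => tf.pullFracModel φ x) h Q odd_l R ιX K' constEmb
        constEmb_injective hinvc hinvp)
      (FrobenioidThetaBiKummer.BiKummerVocabStub.ofBiKummerSetting
        (BiKummerSetting.mkOfConnectedTemperoid X tf hZ hP NH A₀ hA₀ hA₀') (fun {_ _} φ x => tf.pullFracModel φ x) _
        fun _ => (MulEquiv.ofBijective (MonoidHom.id _) Function.bijective_id).symm) :=
  thetaPairIsRoot_ofModelData (pullFrac := fun {_ _} φ x => tf.pullFracModel φ x) h Q odd_l R ιX _ _ K' constEmb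
    constEmb_injective _ _ (fun A x => tf.pullFracModel_id A x)
    (BiKummerSetting.pairIsNthRootOf_comp_mkOfModelCanonical X tf hZ hP _ _ _ NH A₀ hA₀ hA₀' h.isDivisorial Rl R hsk hμ
      hcondA)

end ThetaFrobenioid

end Literature.AnabelianGeometry.EtaleTheta

end
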